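import Mathlib
import Summits.ResolutionOfSingularities.ResolutionOfSingularities.Theses.FrobeniusLadder
import Literature.RingTheory.TightClosure.TightClosure
import Literature.RingTheory.TightClosure.RegularTightlyClosed
import Literature.RingTheory.TightClosure.TestElementsExist
import Literature.AlgebraicGeometry.Resolution.FFinite
import Literature.AlgebraicGeometry.Resolution.ResolutionOfCurves
import Literature.AlgebraicGeometry.Resolution.SmoothUniformizationProofs
import Literature.AlgebraicGeometry.Resolution.RegularLocalRingsFlatDescent
import Summits.ResolutionOfSingularities.ResolutionOfSingularities.Theorems.FrobeniusLadderFRationalModificationPowerLift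
import Summits.ResolutionOfSingularities.ResolutionOfSingularities.Theorems.FrobeniusLadderFRationalModificationExchange
import Summits.ResolutionOfSingularities.ResolutionOfSingularities.Theorems.FrobeniusLadderFRationalModificationAdaptedGenerators
import Summits.ResolutionOfSingularities.ResolutionOfSingularities.Theorems.FrobeniusLadderFRationalModificationSopWeaklyRegular
import Summits.ResolutionOfSingularities.ResolutionOfSingularities.Theorems.FrobeniusLadderRegularStalksClimb
import Summits.ResolutionOfSingularities.ResolutionOfSingularities.Theorems.FRationalModification.Negative.LoadBearing
import Summits.ResolutionOfSingularities.ResolutionOfSingularities.Theorems.FrobeniusLadderFRationalModificationReduction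
import Summits.ResolutionOfSingularities.ResolutionOfSingularities.Theorems.FrobeniusLadderFRationalModificationDivisorCertificate
import Summits.ResolutionOfSingularities.ResolutionOfSingularities.Theorems.FrobeniusLadderFRationalModificationTestElement
import Summits.ResolutionOfSingularities.ResolutionOfSingularities.Theorems.FrobeniusLadderFRationalModificationDeformFWPointwise
import Summits.ResolutionOfSingularities.ResolutionOfSingularities.Theorems.FrobeniusLadderFRationalModificationTestExponent
import Summits.ResolutionOfSingularities.ResolutionOfSingularities.Theorems.FrobeniusLadderFRationalModificationStalkSubmodels

/-!
# Crux `FRationalModification` (stmt-ResolutionOfSingularities-15316) — line `Sketch` (lead skeleton, v8)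

`FRationalModification_of : FRationalModification` (route `ResolutionOfSingularities/FrobeniusLadder`,
rung 3 of the ladder: a Cohen–Macaulay F-injective proper birational model ⇒ an F-rational proper
birational model), assembled from stubs `stub_*`, in the tree's tight-closure vocabulary
(`Literature.RingTheory.TightClosure`: `frobeniusPower`, `tightClosure`, `IsTightlyClosed`,
`IsSystemOfParameters`, `IsFRational`; `Literature.AlgebraicGeometry.Resolution.IsFFinite`).

v8 (lead cycle 5, 2026-08-17) = the registered v7.1 RESHAPED. v7.1's single open stub `stub_cover`
(a proper birational `Y₂ → Y` plus a finite flat certified cover `W → Y₂`, certificates with an inline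
TEST-ELEMENT clause; certified equivalent to the crux, p133789) is replaced by a purely GEOMETRIC
producer statement, and the test-element clause is discharged for ALL ground fields (v7.1/cycle 4 had
it only over F-finite `k`, `CartierCertificateHolds.…`, via Hochster–Huneke 1989 Thm 3.4) by DESCENT to
F-finite submodels:

* `stub_certifiedModel` — THE OPEN TRANSFER (v8 form). Every INTEGRAL separated finite-type `Y/k`
  (`char k = p`, ANY field `k`) with rung-2 stalks has a proper birational `π : W → Y` such that every
  stalk `𝒪_{W,w}` is a domain which EITHER is rung-3 (inline: every ideal generated by a system of
  parameters tightly closed) OR carries a RING CERTIFICATE: `t ∈ 𝔪_w`, `t ≠ 0`, with `𝒪_{W,w}[1/t]` a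
  regular ring and `𝒪_{W,w}/(t)` Cohen–Macaulay and F-injective (every system of parameters of the
  quotient a weakly regular sequence generating a Frobenius-closed ideal — the rung-2 clause of the
  quotient, minus "domain"). No covers, no tight closure in the certificate, no F-finiteness.
  Frames: an F-rational model (rung-3 branch everywhere; cards cartier-crystal-centres,
  socle-discrepancy-certificate); a modification regular off an effective Cartier divisor whose
  local rings are CM F-injective (certificate branch on the divisor, `t` = a local equation; card
  finj-exceptional-divisor-inversion; e.g. a resolution with `D = ∅`, or a locally integral blow-up
  whose exceptional Cartier hull is reduced, CM and F-injective and contains the preimage of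
  `Sing Y`). Implied by the summit (`certifiedModel_of_hasResolution`), by the integral form of the
  crux (`certifiedModel_of_rungThreeModel`, so still EQUIVALENT to the crux), unconditional in
  dimension `≤ 1` (`certifiedModel_of_dim_le_one`); the identity is no witness (Disproof §3,
  `Negative.localRungClimb_false`). [difficulty: open-problem]
* `stub_stalkSubmodels` (NEW, provable — EGA IV₃ §8 spreading out, affine and local) — a stalk
  `𝒪_{X,x}` of a scheme locally of finite type over ANY field `k` of characteristic `p` is faithfully
  flat over a Noetherian F-FINITE ring `S₀` whose image contains any prescribed finite set: take an
  affine chart `Spec (k[x₁..x_N]/P) ∋ x`, the subfield `k₀ ⊆ k` generated over `𝔽_p` by the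
  coefficients of generators of `P` and of lifts of the prescribed elements (finitely generated over
  a perfect field, hence F-finite), `A₀ = k₀[x]/P₀` (so `A = A₀ ⊗_{k₀} k` is free over `A₀`) and
  `S₀ = (A₀)_{𝔭 ∩ A₀}`.
* `stub_testExponent` (NEW, provable) — descended test exponents: in a domain `S` of characteristic
  `p` with such submodels, `g ≠ 0` with `S[1/g]` regular, for all `t₁..t_m, y, c ≠ 0` there is ONE
  `n` with `gⁿ y^b ∈ (t₁^{a₁}, …, t_m^{a_m})` whenever `c` witnesses `y^b ∈ (t^a)^*` — regularity of
  `S₀[1/g]` descends along the faithfully flat `S₀ → S` (Matsumura 23.7 (i), tree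
  `IsRegularLocalRing.of_flat_ringHom`), tight-closure memberships descend
  (`Ideal.comap_map_eq_self_of_faithfullyFlat`), and Hochster–Huneke 1989 Thm 3.4 (PROVED in tree,
  `HochsterHuneke1989_thm34_holds`) gives the exponent on `S₀`.
* `stub_deformFWPointwise` (NEW, provable) — Fedder–Watanabe 1989 Prop. 2.13 with a POINTWISE test
  exponent (one `n` per `(y, c)`, uniform in `q`), which is all the five-line argument uses.
* `stub_divisorCertificate` (p132840), `stub_reduction` (p131378), `stub_powerLift` (p129450),
  `stub_exchange` (p129286), `stub_adaptedGenerators` (p129439), `stub_sopWeaklyRegular` (p130247) —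
  LANDED, wired to the tree theorems below, no `sorry`. (v7.1's `stub_flatDescent` p129202,
  `stub_localChart` p132604, `stub_deformFW` p129504 and the cover certificates p133124/p133789 stay
  in the tree; v8's composition does not need them.)

Composition: at `w ∈ W` (`stub_certifiedModel`) the stalk is a domain; in the rung-3 branch there is
nothing to do; in the certificate branch `stub_divisorCertificate` gives Cohen–Macaulayness and the
Fedder–Watanabe data upstairs, `stub_stalkSubmodels` + `stub_testExponent` give the pointwise test
exponent, and `isFRational_of_FW_pointwise` (`stub_adaptedGenerators` → `stub_deformFWPointwise` →
`stub_powerLift` → `stub_exchange`) makes `𝒪_{W,w}` F-rational, i.e. rung-3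
(`isFRational_iff_of_isDomain`); finally `FRationalModification_of := stub_reduction ∘ (…)`.
Every `sorry` of this file is inside a `stub_*` — v8.2: exactly ONE, `stub_certifiedModel` (OPEN);
`stub_stalkSubmodels` p138571, `stub_testExponent` p137782, `stub_deformFWPointwise` p137336 LANDED (wave 1 of
cycle 5) and are wired below.
-/

noncomputable section

open CategoryTheory AlgebraicGeometry TopologicalSpace IsLocalRing RingTheory.Sequence
open Literature.RingTheory.TightClosure Literature.AlgebraicGeometry.Resolution
open Summit.ResolutionOfSingularities.ResolutionOfSingularities.Theses.FrobeniusLadder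

set_option linter.dupNamespace false

namespace Summit.ResolutionOfSingularities.ResolutionOfSingularities.Cruxes.FRationalModification.Lines.Sketch

/-! ## The landed algebra stubs (wired to the tree, no `sorry`) -/

/-- STUB `stub_powerLift` (LANDED p129450) — raising one parameter to a power keeps the parameter
ideal tightly closed. [cite: FedderWatanabe1989, proof of Prop. 2.2; folklore] -/
theorem stub_powerLift (p : ℕ) [Fact p.Prime] {R : Type*} [CommRing R] [IsDomain R]
    [IsNoetherianRing R] [IsLocalRing R] [CharP R p]
    (hCM : ∀ ⦃n : ℕ⦄ (s : Fin n → R), IsSystemOfParameters s → IsWeaklyRegular R (List.ofFn s))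
    {d : ℕ} (hd : ringKrullDim R = ((d + 1 : ℕ) : WithBot ℕ∞)) {a : R} {u : Fin d → R}
    (hau : (Ideal.span (insert a (Set.range u))).radical = maximalIdeal R)
    (htc : IsTightlyClosed p (Ideal.span (insert a (Set.range u)))) {k : ℕ} (hk : 0 < k) :
    IsTightlyClosed p (Ideal.span (insert (a ^ k) (Set.range u))) :=
  Summit.ResolutionOfSingularities.ResolutionOfSingularities.Theorems.FRationalModification.PowerLift.stub_powerLift p hCM hd hau htc hk

/-- STUB `stub_exchange` (LANDED p129286) — exchanging one parameter.
[cite: FedderWatanabe1989, proof of Prop. 2.2; folklore] -/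
theorem stub_exchange (p : ℕ) [Fact p.Prime] {R : Type*} [CommRing R] [IsDomain R]
    [IsNoetherianRing R] [IsLocalRing R] [CharP R p]
    (hCM : ∀ ⦃n : ℕ⦄ (s : Fin n → R), IsSystemOfParameters s → IsWeaklyRegular R (List.ofFn s))
    {d : ℕ} (hd : ringKrullDim R = ((d + 1 : ℕ) : WithBot ℕ∞)) {a b : R} {u : Fin d → R}
    (ha : (Ideal.span (insert a (Set.range u))).radical = maximalIdeal R)
    (hab : a ∈ Ideal.span (insert b (Set.range u)))
    (htc : IsTightlyClosed p (Ideal.span (insert a (Set.range u)))) :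
    IsTightlyClosed p (Ideal.span (insert b (Set.range u))) :=
  Summit.ResolutionOfSingularities.ResolutionOfSingularities.Theorems.FRationalModification.Exchange.stub_exchange p hCM hd ha hab htc

/-- STUB `stub_adaptedGenerators` (LANDED p129439) — regenerating a parameter ideal around a given
parameter. [cite: Kaplansky1974, Thm. 124 (Davis); folklore] -/
theorem stub_adaptedGenerators {R : Type*} [CommRing R] [IsDomain R] [IsNoetherianRing R]
    [IsLocalRing R] {d : ℕ} (hd : ringKrullDim R = ((d + 1 : ℕ) : WithBot ℕ∞)) {g : R}
    (hg : g ∈ maximalIdeal R) (hg0 : g ≠ 0) (t : Fin (d + 1) → R)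
    (ht : (Ideal.span (Set.range t)).radical = maximalIdeal R) :
    ∃ (b : R) (u : Fin d → R), Ideal.span (Set.range t) = Ideal.span (insert b (Set.range u)) ∧
      (Ideal.span (insert g (Set.range u))).radical = maximalIdeal R :=
  Summit.ResolutionOfSingularities.ResolutionOfSingularities.Theorems.FRationalModification.AdaptedGenerators.stub_adaptedGenerators hd hg hg0 t ht

/-- STUB `stub_sopWeaklyRegular` (LANDED p130247) — Matsumura 17.4 (iii): in a Cohen–Macaulay local
ring every system of parameters is a weakly regular sequence. [cite: Matsumura1987, Thm. 17.4 (iii)] -/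
theorem stub_sopWeaklyRegular {S : Type*} [CommRing S] [IsNoetherianRing S] [IsLocalRing S]
    (hCM : ∃ rs : List S, RingTheory.Sequence.IsRegular S rs ∧ (∀ r ∈ rs, r ∈ maximalIdeal S) ∧
      (rs.length : WithBot ℕ∞) = ringKrullDim S)
    ⦃n : ℕ⦄ (s : Fin n → S) (hs : IsSystemOfParameters s) :
    RingTheory.Sequence.IsWeaklyRegular S (List.ofFn s) :=
  Summit.ResolutionOfSingularities.ResolutionOfSingularities.Theorems.FRationalModification.SopWeaklyRegular.stub_sopWeaklyRegular hCM s hs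

/-- STUB `stub_divisorCertificate` (LANDED p132840) — a divisor certificate yields the
Fedder–Watanabe data upstairs: `S` Noetherian local domain of characteristic `p`, `g ∈ 𝔪_S`, `g ≠ 0`,
`S/(g)` Cohen–Macaulay and F-injective in its own s.o.p. language ⇒ `S` is Cohen–Macaulay (a regular
sequence in `𝔪_S` of length `dim S`) and, with `dim S = d + 1`, for every completion `s` of `g` to a
system of parameters, `y^q ∈ (g) + (s)^[q] ⇒ y ∈ (g, s)`. [cite: FedderWatanabe1989, Prop. 2.13
(hypotheses); Fedder1983; folklore] -/
theorem stub_divisorCertificate (p : ℕ) [Fact p.Prime] {S : Type*} [CommRing S] [IsLocalRing S]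
    [IsNoetherianRing S] [IsDomain S] [CharP S p] {g : S} (hgm : g ∈ maximalIdeal S) (hg0 : g ≠ 0)
    (hD : ∀ d : ℕ, ringKrullDim (S ⧸ Ideal.span {g}) = d → ∀ t : Fin d → S ⧸ Ideal.span {g},
      (Ideal.span (Set.range t)).radical.IsMaximal →
        RingTheory.Sequence.IsWeaklyRegular (S ⧸ Ideal.span {g}) (List.ofFn t) ∧
        ∀ y : S ⧸ Ideal.span {g}, (∃ e : ℕ, y ^ p ^ e ∈
          Ideal.span ((fun z : S ⧸ Ideal.span {g} => z ^ p ^ e) ''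
            (Ideal.span (Set.range t) : Set (S ⧸ Ideal.span {g})))) →
          y ∈ Ideal.span (Set.range t)) :
    (∃ rs : List S, RingTheory.Sequence.IsRegular S rs ∧ (∀ r ∈ rs, r ∈ maximalIdeal S) ∧
        (rs.length : WithBot ℕ∞) = ringKrullDim S) ∧
      ∃ d : ℕ, ringKrullDim S = ((d + 1 : ℕ) : WithBot ℕ∞) ∧
        ∀ s : Fin d → S, (Ideal.span (insert g (Set.range s))).radical = maximalIdeal S →
          ∀ (y : S) (e : ℕ), y ^ p ^ e ∈
            Ideal.span {g} ⊔ frobeniusPower (p ^ e) (Ideal.span (Set.range s)) →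
            y ∈ Ideal.span (insert g (Set.range s)) :=
  Summit.ResolutionOfSingularities.ResolutionOfSingularities.Theorems.FRationalModification.DivisorCertificate.stub_divisorCertificate
    p hgm hg0 hD

/-! ## The reduction stub (landed) -/

/-- STUB `stub_reduction` (LANDED p131378 — geometric plumbing) — **the crux follows from its integral
model form** (clopen integral components of the rung-2 model, disjoint union of the components'
models, composition of proper birational maps). [cite: CossartPiltant2019, proof of Prop. 4.6,
Step 1; folklore] -/
theorem stub_reduction (p : ℕ) (k : Type) [Field k] (X : Scheme.{0}) (f : X ⟶ Spec (.of k))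
    [IsSeparated f] [LocallyOfFiniteType f] [QuasiCompact f]
    (hint : ∀ (Y : Scheme.{0}) (g : Y ⟶ Spec (.of k)), IsSeparated g → LocallyOfFiniteType g →
      QuasiCompact g → IsIntegral Y →
      (∀ y : Y, IsDomain (Y.presheaf.stalk y) ∧ ∀ d : ℕ, ringKrullDim (Y.presheaf.stalk y) = d →
        ∀ s : Fin d → Y.presheaf.stalk y, (Ideal.span (Set.range s)).radical.IsMaximal →
          RingTheory.Sequence.IsWeaklyRegular (Y.presheaf.stalk y) (List.ofFn s) ∧
          ∀ w : Y.presheaf.stalk y, (∃ e : ℕ, w ^ p ^ e ∈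
            Ideal.span ((fun z : Y.presheaf.stalk y => z ^ p ^ e) ''
              (Ideal.span (Set.range s) : Set (Y.presheaf.stalk y)))) →
            w ∈ Ideal.span (Set.range s)) →
      ∃ (Y₂ : Scheme.{0}) (ρ : Y₂ ⟶ Y), IsProper ρ ∧ IsBirational ρ ∧ ∀ x : Y₂,
        IsDomain (Y₂.presheaf.stalk x) ∧ ∀ d : ℕ, ringKrullDim (Y₂.presheaf.stalk x) = d →
          ∀ s : Fin d → Y₂.presheaf.stalk x, (Ideal.span (Set.range s)).radical.IsMaximal →
            ∀ y c : Y₂.presheaf.stalk x, c ≠ 0 →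
              (∀ e : ℕ, c * y ^ p ^ e ∈
                Ideal.span ((fun z : Y₂.presheaf.stalk x => z ^ p ^ e) ''
                  (Ideal.span (Set.range s) : Set (Y₂.presheaf.stalk x)))) →
              y ∈ Ideal.span (Set.range s))
    (hX₁ : ∃ (X₁ : Scheme.{0}) (π : X₁ ⟶ X), IsProper π ∧ IsBirational π ∧ ∀ x : X₁,
      IsDomain (X₁.presheaf.stalk x) ∧ ∀ d : ℕ, ringKrullDim (X₁.presheaf.stalk x) = d →
        ∀ s : Fin d → X₁.presheaf.stalk x, (Ideal.span (Set.range s)).radical.IsMaximal →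
          RingTheory.Sequence.IsWeaklyRegular (X₁.presheaf.stalk x) (List.ofFn s) ∧
          ∀ y : X₁.presheaf.stalk x, (∃ e : ℕ, y ^ p ^ e ∈
            Ideal.span ((fun z : X₁.presheaf.stalk x => z ^ p ^ e) ''
              (Ideal.span (Set.range s) : Set (X₁.presheaf.stalk x)))) →
            y ∈ Ideal.span (Set.range s)) :
    ∃ (X₂ : Scheme.{0}) (π : X₂ ⟶ X), IsProper π ∧ IsBirational π ∧ ∀ x : X₂,
      IsDomain (X₂.presheaf.stalk x) ∧ ∀ d : ℕ, ringKrullDim (X₂.presheaf.stalk x) = d →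
        ∀ s : Fin d → X₂.presheaf.stalk x, (Ideal.span (Set.range s)).radical.IsMaximal →
          ∀ y c : X₂.presheaf.stalk x, c ≠ 0 →
            (∀ e : ℕ, c * y ^ p ^ e ∈
              Ideal.span ((fun z : X₂.presheaf.stalk x => z ^ p ^ e) ''
                (Ideal.span (Set.range s) : Set (X₂.presheaf.stalk x)))) →
            y ∈ Ideal.span (Set.range s) :=
  Summit.ResolutionOfSingularities.ResolutionOfSingularities.Theorems.FRationalModification.Reduction.stub_reduction
    p k X f hint hX₁

/-! ## The three new provable stubs of v8 (descent of the test-element clause to ALL fields) -/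

/-- STUB `stub_deformFWPointwise` (LANDED p137336; Fedder–Watanabe 1989, Prop. 2.13 with a POINTWISE test
exponent). `(R, 𝔪)` a Noetherian local domain of characteristic `p` and dimension `d + 1` in which
every system of parameters is a weakly regular sequence; `(f, s)` a parameter ideal such that `R/fR`
is F-injective at `s`, written upstairs (`y^q ∈ (f) + (s)^[q] ⇒ y ∈ (f, s)`); and for every `y` and
every witness `c ≠ 0` of `y ∈ (f, s)^*` (`c y^q ∈ (f, s)^[q]` for all `q`) there is an exponent `n`
with `fⁿ y^q ∈ (f^q, s₁^q, …, s_d^q)` for ALL `q = p^e`. Then `(f, s)` is tightly closed: for such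
`y`, pick `q > n`; `fⁿ y^q = a f^q + b`, `b ∈ (s)^[q]`; `fⁿ (y^q − a f^{q−n}) ∈ (s)^[q]` and `fⁿ` is
regular modulo `(s)^[q]`, so `y^q ∈ (f) + (s)^[q]`, whence `y ∈ (f, s)`. (The landed `stub_deformFW`,
p129504, is the same with one `n` for all parameter ideals; its proof uses the test exponent exactly
once, on `(f^q, s^q)` and `y^q`.) [cite: FedderWatanabe1989, Prop. 2.13] -/
theorem stub_deformFWPointwise (p : ℕ) [Fact p.Prime] {R : Type*} [CommRing R] [IsDomain R]
    [IsNoetherianRing R] [IsLocalRing R] [CharP R p]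
    (hCM : ∀ ⦃n : ℕ⦄ (s : Fin n → R), IsSystemOfParameters s → IsWeaklyRegular R (List.ofFn s))
    {d : ℕ} (hd : ringKrullDim R = ((d + 1 : ℕ) : WithBot ℕ∞)) {f : R} {s : Fin d → R}
    (hs : (Ideal.span (insert f (Set.range s))).radical = maximalIdeal R)
    (hFinj : ∀ (y : R) (e : ℕ),
      y ^ p ^ e ∈ Ideal.span {f} ⊔ frobeniusPower (p ^ e) (Ideal.span (Set.range s)) →
        y ∈ Ideal.span (insert f (Set.range s)))
    (htest : ∀ y c : R, c ≠ 0 →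
      (∀ e : ℕ, c * y ^ p ^ e ∈ frobeniusPower (p ^ e) (Ideal.span (insert f (Set.range s)))) →
      ∃ n : ℕ, ∀ e : ℕ, f ^ n * y ^ p ^ e ∈
        Ideal.span (insert (f ^ p ^ e) (Set.range fun i => s i ^ p ^ e))) :
    IsTightlyClosed p (Ideal.span (insert f (Set.range s))) :=
  Summit.ResolutionOfSingularities.ResolutionOfSingularities.Theorems.FRationalModification.DeformFWPointwise.stub_deformFWPointwise
    p hCM hd hs hFinj htest

/-- STUB `stub_testExponent` (LANDED p137782; descended test exponents). `S` a domain of characteristic `p`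
admitting, through every finite subset, a faithfully flat Noetherian F-finite submodel
(`S₀ → S` faithfully flat, `S₀` Noetherian and F-finite, the subset in the image); `g ≠ 0` with
`S[1/g]` a regular ring. Then for all `t : Fin m → S`, `y` and `c ≠ 0` there is ONE exponent `n` such
that for all exponent vectors `a` and all `b`: if `c` witnesses `y^b ∈ (t₁^{a₁}, …, t_m^{a_m})^*`
(`c (y^b)^q ∈ (t^a)^[q]` for all `q`), then `gⁿ y^b ∈ (t^a)`. Proof: choose `S₀` through
`{g, t_i, y, c}`; `S₀` is reduced of characteristic `p` (it embeds in `S`), `g` is a non-zero-divisor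
of `S₀`, and `S₀[1/g]` is regular — its localizations at primes are dominated, flatly and locally, by
localizations of `S[1/g]` (faithful flatness: `PrimeSpectrum.comap_surjective_of_faithfullyFlat`,
`RingHom.Flat.localRingHom`; Matsumura 23.7 (i): tree `IsRegularLocalRing.of_flat_ringHom`); so
Hochster–Huneke 1989 Thm 3.4 (tree `HochsterHuneke1989_thm34_holds`) gives `n` with `gⁿ I^* ⊆ I` for
every ideal `I ⊆ S₀`; the memberships `c (y^b)^q ∈ (t^a)^[q]` descend to `S₀`
(`Ideal.comap_map_eq_self_of_faithfullyFlat`, `frobeniusPower` commutes with extension), so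
`y₀^b ∈ ((t₀^a))^*` in `S₀` and `gⁿ y^b ∈ (t^a)`. [cite: HochsterHuneke1989, Thm. 3.4;
Matsumura1987, Thm. 23.7 (i); folklore] -/
theorem stub_testExponent (p : ℕ) [Fact p.Prime] {S : Type} [CommRing S] [IsDomain S] [CharP S p]
    (hmod : ∀ F : Finset S, ∃ (S₀ : Type) (_ : CommRing S₀) (_ : Algebra S₀ S),
      IsNoetherianRing S₀ ∧ IsFFinite p 1 S₀ ∧ Module.FaithfullyFlat S₀ S ∧
        (↑F : Set S) ⊆ Set.range (algebraMap S₀ S))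
    {g : S} (hg0 : g ≠ 0) (hreg : IsRegularRing (Localization.Away g))
    {m : ℕ} (t : Fin m → S) (y c : S) (hc : c ≠ 0) :
    ∃ n : ℕ, ∀ (a : Fin m → ℕ) (b : ℕ),
      (∀ e : ℕ, c * (y ^ b) ^ p ^ e ∈
        frobeniusPower (p ^ e) (Ideal.span (Set.range fun i => t i ^ a i))) →
      g ^ n * y ^ b ∈ Ideal.span (Set.range fun i => t i ^ a i) :=
  Summit.ResolutionOfSingularities.ResolutionOfSingularities.Theorems.FRationalModification.TestExponent.stub_testExponent
    p hmod hg0 hreg t y c hc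

/-- STUB `stub_stalkSubmodels` (LANDED p138571; EGA IV₃ §8 "spreading out", affine-local form). For a scheme
`X` locally of finite type over a field `k` of characteristic `p` and `x ∈ X`, the stalk `𝒪_{X,x}` has,
through every finite subset `F`, a faithfully flat Noetherian F-finite submodel: a Noetherian ring
`S₀`, F-finite (`IsFFinite p 1 S₀`), with an algebra map `S₀ → 𝒪_{X,x}` making `𝒪_{X,x}` faithfully
flat over `S₀` and containing `F` in its image. Construction: an affine open `x ∈ U = Spec A`,
`A = k[x₁, …, x_N]/P` of finite type over `k` (`Scheme.Hom.finiteType_appLE`,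
`Algebra.FiniteType.iff_quotient_mvPolynomial''`), `𝒪_{X,x} = A_𝔭`
(`IsAffineOpen.isLocalization_stalk`); write the elements of `F` as fractions and choose polynomial
lifts of their numerators and denominators and generators `h₁, …, h_r` of `P`; let `k₀ ⊆ k` be the
subfield generated over `𝔽_p` by all their coefficients — finitely generated over the perfect field
`𝔽_p`, hence F-finite (`isFFinite_of_finiteType_of_perfectRing`, `IsFFinite.of_isLocalization`);
`A₀ := k₀[x]/(h₁, …, h_r)`, so that `A ≅ k ⊗_{k₀} A₀` (`tensorQuotientMvPolynomialEquiv`) is flat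
over `A₀` (base change of the field extension), `A₀` is of finite type over `k₀` hence Noetherian and
F-finite (`IsFFinite.of_finiteType`); finally `S₀ := (A₀)_{𝔭 ∩ A₀} → A_𝔭` is flat
(`RingHom.Flat.localRingHom`) and local, hence faithfully flat
(`Module.FaithfullyFlat.of_flat_of_isLocalHom`), Noetherian and F-finite (localisation).
[cite: EGAIV3, Prop. 8.9.1; Kunz1969, §1; folklore] -/
theorem stub_stalkSubmodels (p : ℕ) [Fact p.Prime] {k : Type} [Field k] [CharP k p]
    {X : Scheme.{0}} (f : X ⟶ Spec (.of k)) [LocallyOfFiniteType f] (x : X)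
    (F : Finset (X.presheaf.stalk x)) :
    ∃ (S₀ : Type) (_ : CommRing S₀) (_ : Algebra S₀ (X.presheaf.stalk x)),
      IsNoetherianRing S₀ ∧ IsFFinite p 1 S₀ ∧ Module.FaithfullyFlat S₀ (X.presheaf.stalk x) ∧
        (↑F : Set (X.presheaf.stalk x)) ⊆ Set.range (algebraMap S₀ (X.presheaf.stalk x)) :=
  Summit.ResolutionOfSingularities.ResolutionOfSingularities.Theorems.FRationalModification.StalkSubmodels.stub_stalkSubmodels
    p f x F

/-! ## The open stub of v8 -/

/-- STUB `stub_certifiedModel` (OPEN — the transfer, v8 form; cards `finj-exceptional-divisor-inversion`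
(C⁺), `cartier-crystal-centres` / `socle-discrepancy-certificate` (rung-3 branch),
`flatten-the-alteration` (apply `Cover.rungThree_of_coverPoint` first)). For every prime `p`, field
`k` of characteristic `p` and INTEGRAL separated `Y/k` of finite type whose stalks are rung-2
(domain; every system of parameters a weakly regular sequence generating a Frobenius-closed ideal —
the crux's antecedent clause; logically idle, it is the line device the cards consume), there is a
proper birational `π : W → Y` such that EVERY stalk `𝒪_{W,w}` is a domain which EITHER is rung-3
(every ideal generated by a system of parameters tightly closed, inline form) OR carries a ring
certificate: `t ∈ 𝔪_w`, `t ≠ 0`, with `𝒪_{W,w}[1/t]` a regular ring (Mathlib `IsRegularRing`) and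
`𝒪_{W,w}/(t)` Cohen–Macaulay and F-injective in its own system-of-parameters language. Typical
witness shape: `W` locally integral and regular off an effective Cartier divisor `D` whose local
rings `𝒪_{W,w}/(t_w)` (`t_w` a local equation) are CM and F-injective — then off `D` the stalks are
regular (hence rung-3, `Negative.rungThree_of_isRegularLocalRing`) and on `D` the certificate holds
with `t = t_w` (`TestElement.isRegularRing_away_of_generizations`). Implied by the integral form of
the crux (`certifiedModel_of_rungThreeModel`, hence EQUIVALENT to the crux), by the summit
(`certifiedModel_of_hasResolution`), unconditional in dimension `≤ 1` (`certifiedModel_of_dim_le_one`);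
the identity `W = Y` does NOT work (Disproof §3, `Negative.localRungClimb_false`: the curve germ
`𝔽_p + X𝔽_{p²}⟦X⟧` is rung-2, not rung-3, and not regular off any `t ∈ 𝔪 ∖ 0` either — it is its
own `𝒪[1/t] =` fraction field, regular, but `𝒪/(t)` is not reduced for `t = X`: so a certificate at a
NON-NORMAL point needs `t` with reduced `𝒪/(t)`, impossible in dimension one).
[difficulty: open-problem] -/
theorem stub_certifiedModel (p : ℕ) [Fact p.Prime] (k : Type) [Field k] [CharP k p] (Y : Scheme.{0})
    (g : Y ⟶ Spec (.of k)) [IsSeparated g] [LocallyOfFiniteType g] [QuasiCompact g] [IsIntegral Y]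
    (h₂ : ∀ y : Y, IsDomain (Y.presheaf.stalk y) ∧ ∀ d : ℕ, ringKrullDim (Y.presheaf.stalk y) = d →
      ∀ s : Fin d → Y.presheaf.stalk y, (Ideal.span (Set.range s)).radical.IsMaximal →
        RingTheory.Sequence.IsWeaklyRegular (Y.presheaf.stalk y) (List.ofFn s) ∧
        ∀ w : Y.presheaf.stalk y, (∃ e : ℕ, w ^ p ^ e ∈
          Ideal.span ((fun z : Y.presheaf.stalk y => z ^ p ^ e) ''
            (Ideal.span (Set.range s) : Set (Y.presheaf.stalk y)))) →
          w ∈ Ideal.span (Set.range s)) :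
    ∃ (W : Scheme.{0}) (π : W ⟶ Y), IsProper π ∧ IsBirational π ∧ ∀ w : W,
      IsDomain (W.presheaf.stalk w) ∧
      ((∀ d : ℕ, ringKrullDim (W.presheaf.stalk w) = d → ∀ s : Fin d → W.presheaf.stalk w,
          (Ideal.span (Set.range s)).radical.IsMaximal → ∀ y c : W.presheaf.stalk w, c ≠ 0 →
            (∀ e : ℕ, c * y ^ p ^ e ∈
              Ideal.span ((fun z : W.presheaf.stalk w => z ^ p ^ e) ''
                (Ideal.span (Set.range s) : Set (W.presheaf.stalk w)))) →
            y ∈ Ideal.span (Set.range s)) ∨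
        ∃ t : W.presheaf.stalk w, t ∈ maximalIdeal (W.presheaf.stalk w) ∧ t ≠ 0 ∧
          IsRegularRing (Localization.Away t) ∧
          ∀ d : ℕ, ringKrullDim (W.presheaf.stalk w ⧸ Ideal.span {t}) = d →
            ∀ u : Fin d → W.presheaf.stalk w ⧸ Ideal.span {t},
              (Ideal.span (Set.range u)).radical.IsMaximal →
                RingTheory.Sequence.IsWeaklyRegular (W.presheaf.stalk w ⧸ Ideal.span {t})
                  (List.ofFn u) ∧
                ∀ y : W.presheaf.stalk w ⧸ Ideal.span {t}, (∃ e : ℕ, y ^ p ^ e ∈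
                  Ideal.span ((fun z : W.presheaf.stalk w ⧸ Ideal.span {t} => z ^ p ^ e) ''
                    (Ideal.span (Set.range u) : Set (W.presheaf.stalk w ⧸ Ideal.span {t})))) →
                  y ∈ Ideal.span (Set.range u)) := by
  sorry

/-! ## Glue lemmas (proved) -/

section Glue

variable {R : Type*} [CommRing R]

/-- Two families of generators lying in each other's radical generate ideals with the same radical. -/
theorem radical_span_eq_of_subset_radical {A B : Set R}
    (hAB : A ⊆ (Ideal.span B).radical) (hBA : B ⊆ (Ideal.span A).radical) :
    (Ideal.span A).radical = (Ideal.span B).radical :=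
  le_antisymm (Ideal.radical_le_radical_iff.mpr (Ideal.span_le.mpr hAB))
    (Ideal.radical_le_radical_iff.mpr (Ideal.span_le.mpr hBA))

/-- Raising the distinguished generator of `(f, s)` to a positive power does not change the
radical. -/
theorem radical_span_insert_pow_eq {d : ℕ} (f : R) (s : Fin d → R) {a : ℕ} (ha : 0 < a) :
    (Ideal.span (insert (f ^ a) (Set.range s))).radical =
      (Ideal.span (insert f (Set.range s))).radical := by
  have hf : f ∈ Ideal.span (insert f (Set.range s)) := Ideal.subset_span (Set.mem_insert _ _)
  have hs : ∀ i, s i ∈ Ideal.span (insert f (Set.range s)) := fun i =>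
    Ideal.subset_span (Set.mem_insert_of_mem _ (Set.mem_range_self i))
  have hfa : f ^ a ∈ Ideal.span (insert (f ^ a) (Set.range s)) :=
    Ideal.subset_span (Set.mem_insert _ _)
  have hsa : ∀ i, s i ∈ Ideal.span (insert (f ^ a) (Set.range s)) := fun i =>
    Ideal.subset_span (Set.mem_insert_of_mem _ (Set.mem_range_self i))
  apply radical_span_eq_of_subset_radical
  · rintro x (rfl | ⟨i, rfl⟩)
    · exact Ideal.le_radical (Ideal.pow_mem_of_mem _ hf _ ha)
    · exact Ideal.le_radical (hs i)
  · rintro x (rfl | ⟨i, rfl⟩)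
    · exact Ideal.mem_radical_iff.mpr ⟨a, hfa⟩
    · exact Ideal.le_radical (hsa i)

end Glue

/-! ## The pointwise test exponent in the Fedder–Watanabe shape (proved modulo `stub_testExponent`) -/

/-- From `stub_testExponent`: the POINTWISE test-exponent clause that `stub_deformFWPointwise` consumes,
for the parameter ideal `(f, s)` of a domain `S` with submodels, `S[1/f]` regular. -/
theorem testExponent_FW (p : ℕ) [Fact p.Prime] {S : Type} [CommRing S] [IsDomain S] [CharP S p]
    (hmod : ∀ F : Finset S, ∃ (S₀ : Type) (_ : CommRing S₀) (_ : Algebra S₀ S),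
      IsNoetherianRing S₀ ∧ IsFFinite p 1 S₀ ∧ Module.FaithfullyFlat S₀ S ∧
        (↑F : Set S) ⊆ Set.range (algebraMap S₀ S))
    {f : S} (hf0 : f ≠ 0) (hreg : IsRegularRing (Localization.Away f)) {d : ℕ} (s : Fin d → S)
    (y c : S) (hc : c ≠ 0)
    (hcy : ∀ e : ℕ, c * y ^ p ^ e ∈ frobeniusPower (p ^ e) (Ideal.span (insert f (Set.range s)))) :
    ∃ n : ℕ, ∀ e : ℕ, f ^ n * y ^ p ^ e ∈
      Ideal.span (insert (f ^ p ^ e) (Set.range fun i => s i ^ p ^ e)) := by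
  obtain ⟨n, hn⟩ := stub_testExponent p hmod hf0 hreg (Fin.cons f s) y c hc
  refine ⟨n, fun e => ?_⟩
  have hrange : (Set.range fun i => (Fin.cons f s : Fin (d + 1) → S) i ^ p ^ e) =
      insert (f ^ p ^ e) (Set.range fun i => s i ^ p ^ e) := by
    have : (fun i => (Fin.cons f s : Fin (d + 1) → S) i ^ p ^ e) =
        Fin.cons (f ^ p ^ e) (fun i => s i ^ p ^ e) := by
      ext i
      refine Fin.cases ?_ (fun j => ?_) i <;> simp
    rw [this, Fin.range_cons]
  have h := hn (fun _ => p ^ e) (p ^ e) (fun e' => ?_)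
  · rwa [hrange] at h
  · rw [hrange, ← pow_mul, ← pow_add]
    have hins : Ideal.span (insert (f ^ p ^ e) (Set.range fun i => s i ^ p ^ e)) =
        frobeniusPower (p ^ e) (Ideal.span (insert f (Set.range s))) := by
      rw [frobeniusPower_span, Set.image_insert_eq, ← Set.range_comp]
      rfl
    rw [hins, frobeniusPower_frobeniusPower]
    exact hcy (e + e')

/-! ## F-rationality from the Fedder–Watanabe data with pointwise test exponents -/

/-- From the Fedder–Watanabe data on a Noetherian local domain `S` of characteristic `p`
(Cohen–Macaulay; `g ∈ 𝔪`, `g ≠ 0`, with `S/gS` F-injective upstairs at every completion of `g`) and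
the pointwise test exponents of `testExponent_FW` (submodels + `S[1/g]` regular), `S` is F-rational:
regenerate a parameter ideal `(t)` as `(b, u)` around a completion `u` of `g`
(`stub_adaptedGenerators`), get `(g, u)` tightly closed (`stub_deformFWPointwise`), lift to `(gᴺ, u)`
with `gᴺ ∈ (t)` (`stub_powerLift`), and exchange `gᴺ` for `b` (`stub_exchange`). -/
theorem isFRational_of_FW_pointwise (p : ℕ) [Fact p.Prime] {S : Type} [CommRing S] [IsLocalRing S]
    [IsNoetherianRing S] [IsDomain S] [CharP S p]
    (hmod : ∀ F : Finset S, ∃ (S₀ : Type) (_ : CommRing S₀) (_ : Algebra S₀ S),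
      IsNoetherianRing S₀ ∧ IsFFinite p 1 S₀ ∧ Module.FaithfullyFlat S₀ S ∧
        (↑F : Set S) ⊆ Set.range (algebraMap S₀ S))
    (hCM : ∀ ⦃n : ℕ⦄ (s : Fin n → S), IsSystemOfParameters s → IsWeaklyRegular S (List.ofFn s))
    {d : ℕ} {g : S} (hd : ringKrullDim S = ((d + 1 : ℕ) : WithBot ℕ∞))
    (hgm : g ∈ maximalIdeal S) (hg0 : g ≠ 0) (hreg : IsRegularRing (Localization.Away g))
    (hFinj : ∀ s : Fin d → S, (Ideal.span (insert g (Set.range s))).radical = maximalIdeal S →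
      ∀ (y : S) (e : ℕ), y ^ p ^ e ∈
        Ideal.span {g} ⊔ frobeniusPower (p ^ e) (Ideal.span (Set.range s)) →
        y ∈ Ideal.span (insert g (Set.range s))) :
    IsFRational S p := by
  intro n t ht
  obtain ⟨hdim, hrad⟩ := ht
  -- `n = d + 1`
  have hn : n = d + 1 := by
    have h := hdim.symm.trans hd
    exact_mod_cast h
  subst hn
  -- regenerate `(t) = (b, u)` with `(g, u)` a parameter ideal
  obtain ⟨b, u, htu, hgu⟩ := stub_adaptedGenerators hd hgm hg0 t hrad
  -- `(g, u)` is tightly closed (FW 2.13, pointwise test exponents)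
  have hgu_tc : IsTightlyClosed p (Ideal.span (insert g (Set.range u))) :=
    stub_deformFWPointwise p hCM hd hgu (hFinj u hgu)
      (fun y c hc hcy => testExponent_FW p hmod hg0 hreg u y c hc hcy)
  -- cofinality: `g^(N+1) ∈ 𝔪^(N+1) ⊆ (t) = (b, u)`
  obtain ⟨N, hN⟩ := Ideal.exists_pow_le_of_le_radical_of_fg hrad.ge
    (IsNoetherian.noetherian (maximalIdeal S))
  have hgN : g ^ (N + 1) ∈ Ideal.span (insert b (Set.range u)) := by
    rw [← htu]
    exact ((Ideal.pow_le_pow_right (Nat.le_succ N)).trans hN) (Ideal.pow_mem_pow hgm _)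
  -- lift the power of `g`, then exchange `g^(N+1)` for `b`
  have hgNu_tc : IsTightlyClosed p (Ideal.span (insert (g ^ (N + 1)) (Set.range u))) :=
    stub_powerLift p hCM hd hgu hgu_tc (Nat.succ_pos N)
  have hgNu_rad : (Ideal.span (insert (g ^ (N + 1)) (Set.range u))).radical = maximalIdeal S := by
    rw [radical_span_insert_pow_eq g u (Nat.succ_pos N), hgu]
  rw [htu]
  exact stub_exchange p hCM hd hgNu_rad hgN hgNu_tc

/-- **The ring certificate makes a local domain with submodels F-rational**: `S` Noetherian local
domain of characteristic `p` with faithfully flat Noetherian F-finite submodels through every finite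
subset, `t ∈ 𝔪 ∖ 0` with `S[1/t]` regular and `S/(t)` Cohen–Macaulay F-injective ⇒ `S` F-rational
(`stub_divisorCertificate` for the Fedder–Watanabe data, then `isFRational_of_FW_pointwise`). Over an
F-finite `S` this is `CartierCertificateHolds.isFRational_of_divisorCertificate_of_isRegularRing_away`
(cycle 4); here NO F-finiteness is assumed. -/
theorem isFRational_of_ringCertificate (p : ℕ) [Fact p.Prime] {S : Type} [CommRing S]
    [IsLocalRing S] [IsNoetherianRing S] [IsDomain S] [CharP S p]
    (hmod : ∀ F : Finset S, ∃ (S₀ : Type) (_ : CommRing S₀) (_ : Algebra S₀ S),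
      IsNoetherianRing S₀ ∧ IsFFinite p 1 S₀ ∧ Module.FaithfullyFlat S₀ S ∧
        (↑F : Set S) ⊆ Set.range (algebraMap S₀ S))
    {t : S} (htm : t ∈ maximalIdeal S) (ht0 : t ≠ 0) (hreg : IsRegularRing (Localization.Away t))
    (hD : ∀ d : ℕ, ringKrullDim (S ⧸ Ideal.span {t}) = d → ∀ u : Fin d → S ⧸ Ideal.span {t},
      (Ideal.span (Set.range u)).radical.IsMaximal →
        RingTheory.Sequence.IsWeaklyRegular (S ⧸ Ideal.span {t}) (List.ofFn u) ∧
        ∀ y : S ⧸ Ideal.span {t}, (∃ e : ℕ, y ^ p ^ e ∈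
          Ideal.span ((fun z : S ⧸ Ideal.span {t} => z ^ p ^ e) ''
            (Ideal.span (Set.range u) : Set (S ⧸ Ideal.span {t})))) →
          y ∈ Ideal.span (Set.range u)) :
    IsFRational S p := by
  obtain ⟨hCM, d, hd, hFinj⟩ := stub_divisorCertificate p htm ht0 hD
  exact isFRational_of_FW_pointwise p hmod (fun n s hs => stub_sopWeaklyRegular hCM s hs) hd htm
    ht0 hreg hFinj

/-- **A certified stalk of a `k`-scheme is rung-3, for ANY field `k` of characteristic `p`.**
`f : X → Spec k` locally of finite type, `x ∈ X` with `𝒪_{X,x}` a domain that is either rung-3 or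
carries a ring certificate (`t ∈ 𝔪 ∖ 0`, `𝒪[1/t]` regular, `𝒪/(t)` CM F-injective); then `𝒪_{X,x}`
satisfies the crux's rung-3 clause (`stub_stalkSubmodels` + `isFRational_of_ringCertificate` +
`isFRational_iff_of_isDomain`). -/
theorem rungThree_of_certificate (p : ℕ) [Fact p.Prime] {k : Type} [Field k] [CharP k p]
    {X : Scheme.{0}} (f : X ⟶ Spec (.of k)) [LocallyOfFiniteType f] (x : X)
    [IsDomain (X.presheaf.stalk x)]
    (hx : (∀ d : ℕ, ringKrullDim (X.presheaf.stalk x) = d → ∀ s : Fin d → X.presheaf.stalk x,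
        (Ideal.span (Set.range s)).radical.IsMaximal → ∀ y c : X.presheaf.stalk x, c ≠ 0 →
          (∀ e : ℕ, c * y ^ p ^ e ∈
            Ideal.span ((fun z : X.presheaf.stalk x => z ^ p ^ e) ''
              (Ideal.span (Set.range s) : Set (X.presheaf.stalk x)))) →
          y ∈ Ideal.span (Set.range s)) ∨
      ∃ t : X.presheaf.stalk x, t ∈ maximalIdeal (X.presheaf.stalk x) ∧ t ≠ 0 ∧
        IsRegularRing (Localization.Away t) ∧
        ∀ d : ℕ, ringKrullDim (X.presheaf.stalk x ⧸ Ideal.span {t}) = d →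
          ∀ u : Fin d → X.presheaf.stalk x ⧸ Ideal.span {t},
            (Ideal.span (Set.range u)).radical.IsMaximal →
              RingTheory.Sequence.IsWeaklyRegular (X.presheaf.stalk x ⧸ Ideal.span {t})
                (List.ofFn u) ∧
              ∀ y : X.presheaf.stalk x ⧸ Ideal.span {t}, (∃ e : ℕ, y ^ p ^ e ∈
                Ideal.span ((fun z : X.presheaf.stalk x ⧸ Ideal.span {t} => z ^ p ^ e) ''
                  (Ideal.span (Set.range u) : Set (X.presheaf.stalk x ⧸ Ideal.span {t})))) →
                y ∈ Ideal.span (Set.range u)) :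
    ∀ d : ℕ, ringKrullDim (X.presheaf.stalk x) = d → ∀ s : Fin d → X.presheaf.stalk x,
      (Ideal.span (Set.range s)).radical.IsMaximal → ∀ y c : X.presheaf.stalk x, c ≠ 0 →
        (∀ e : ℕ, c * y ^ p ^ e ∈
          Ideal.span ((fun z : X.presheaf.stalk x => z ^ p ^ e) ''
            (Ideal.span (Set.range s) : Set (X.presheaf.stalk x)))) →
        y ∈ Ideal.span (Set.range s) := by
  rcases hx with h3 | ⟨t, htm, ht0, hreg, hD⟩
  · exact h3
  · haveI : IsLocallyNoetherian X := LocallyOfFiniteType.isLocallyNoetherian f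
    haveI : CharP (X.presheaf.stalk x) p :=
      Summit.ResolutionOfSingularities.ResolutionOfSingularities.Theorems.FRationalModification.Negative.charP_stalk
        f x
    exact (isFRational_iff_of_isDomain p).mp
      (isFRational_of_ringCertificate p (stub_stalkSubmodels p f x) htm ht0 hreg hD)

/-! ## Remarks on the open stub (proved): rung-3 models witness it; consistency; dimension `≤ 1` -/

/-- **A rung-3 model is a certified model** (rung-3 branch at every point): so `stub_certifiedModel`
is implied by the integral form of the crux (hence EQUIVALENT to the crux, the converse being
`FRationalModification_of` with `stub_reduction`; cf. `IntegralForm.fRationalModification_iff_integral`,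
p131587). [folklore] -/
theorem certifiedModel_of_rungThreeModel (p : ℕ) {Y : Scheme.{0}}
    (h : ∃ (Y₂ : Scheme.{0}) (π : Y₂ ⟶ Y), IsProper π ∧ IsBirational π ∧ ∀ x : Y₂,
      IsDomain (Y₂.presheaf.stalk x) ∧ ∀ d : ℕ, ringKrullDim (Y₂.presheaf.stalk x) = d →
        ∀ s : Fin d → Y₂.presheaf.stalk x, (Ideal.span (Set.range s)).radical.IsMaximal →
          ∀ y c : Y₂.presheaf.stalk x, c ≠ 0 →
            (∀ e : ℕ, c * y ^ p ^ e ∈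
              Ideal.span ((fun z : Y₂.presheaf.stalk x => z ^ p ^ e) ''
                (Ideal.span (Set.range s) : Set (Y₂.presheaf.stalk x)))) →
            y ∈ Ideal.span (Set.range s)) :
    ∃ (W : Scheme.{0}) (π : W ⟶ Y), IsProper π ∧ IsBirational π ∧ ∀ w : W,
      IsDomain (W.presheaf.stalk w) ∧
      ((∀ d : ℕ, ringKrullDim (W.presheaf.stalk w) = d → ∀ s : Fin d → W.presheaf.stalk w,
          (Ideal.span (Set.range s)).radical.IsMaximal → ∀ y c : W.presheaf.stalk w, c ≠ 0 →
            (∀ e : ℕ, c * y ^ p ^ e ∈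
              Ideal.span ((fun z : W.presheaf.stalk w => z ^ p ^ e) ''
                (Ideal.span (Set.range s) : Set (W.presheaf.stalk w)))) →
            y ∈ Ideal.span (Set.range s)) ∨
        ∃ t : W.presheaf.stalk w, t ∈ maximalIdeal (W.presheaf.stalk w) ∧ t ≠ 0 ∧
          IsRegularRing (Localization.Away t) ∧
          ∀ d : ℕ, ringKrullDim (W.presheaf.stalk w ⧸ Ideal.span {t}) = d →
            ∀ u : Fin d → W.presheaf.stalk w ⧸ Ideal.span {t},
              (Ideal.span (Set.range u)).radical.IsMaximal →
                RingTheory.Sequence.IsWeaklyRegular (W.presheaf.stalk w ⧸ Ideal.span {t})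
                  (List.ofFn u) ∧
                ∀ y : W.presheaf.stalk w ⧸ Ideal.span {t}, (∃ e : ℕ, y ^ p ^ e ∈
                  Ideal.span ((fun z : W.presheaf.stalk w ⧸ Ideal.span {t} => z ^ p ^ e) ''
                    (Ideal.span (Set.range u) : Set (W.presheaf.stalk w ⧸ Ideal.span {t})))) →
                  y ∈ Ideal.span (Set.range u)) := by
  obtain ⟨Y₂, π, hπ, hbir, h3⟩ := h
  exact ⟨Y₂, π, hπ, hbir, fun x => ⟨(h3 x).1, Or.inl (h3 x).2⟩⟩

/-- **A resolution of `Y` witnesses `stub_certifiedModel` for `Y`** (rung-3 branch: regular local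
rings of characteristic `p` are rung-3, tree `Negative.rungThree_of_isRegularLocalRing` /
`RegularStalksClimb`). So the open stub is implied by the summit and cannot be refuted short of
`¬ResolutionOfSingularities`. [folklore] -/
theorem certifiedModel_of_hasResolution (p : ℕ) [Fact p.Prime] (k : Type) [Field k] [CharP k p]
    (Y : Scheme.{0}) (g : Y ⟶ Spec (.of k)) [LocallyOfFiniteType g] (hres : Scheme.HasResolution Y) :
    ∃ (W : Scheme.{0}) (π : W ⟶ Y), IsProper π ∧ IsBirational π ∧ ∀ w : W,
      IsDomain (W.presheaf.stalk w) ∧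
      ((∀ d : ℕ, ringKrullDim (W.presheaf.stalk w) = d → ∀ s : Fin d → W.presheaf.stalk w,
          (Ideal.span (Set.range s)).radical.IsMaximal → ∀ y c : W.presheaf.stalk w, c ≠ 0 →
            (∀ e : ℕ, c * y ^ p ^ e ∈
              Ideal.span ((fun z : W.presheaf.stalk w => z ^ p ^ e) ''
                (Ideal.span (Set.range s) : Set (W.presheaf.stalk w)))) →
            y ∈ Ideal.span (Set.range s)) ∨
        ∃ t : W.presheaf.stalk w, t ∈ maximalIdeal (W.presheaf.stalk w) ∧ t ≠ 0 ∧
          IsRegularRing (Localization.Away t) ∧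
          ∀ d : ℕ, ringKrullDim (W.presheaf.stalk w ⧸ Ideal.span {t}) = d →
            ∀ u : Fin d → W.presheaf.stalk w ⧸ Ideal.span {t},
              (Ideal.span (Set.range u)).radical.IsMaximal →
                RingTheory.Sequence.IsWeaklyRegular (W.presheaf.stalk w ⧸ Ideal.span {t})
                  (List.ofFn u) ∧
                ∀ y : W.presheaf.stalk w ⧸ Ideal.span {t}, (∃ e : ℕ, y ^ p ^ e ∈
                  Ideal.span ((fun z : W.presheaf.stalk w ⧸ Ideal.span {t} => z ^ p ^ e) ''
                    (Ideal.span (Set.range u) : Set (W.presheaf.stalk w ⧸ Ideal.span {t})))) →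
                  y ∈ Ideal.span (Set.range u)) := by
  refine certifiedModel_of_rungThreeModel p ?_
  obtain ⟨Y₂, π, hπ⟩ := hres
  haveI := hπ.isProper
  refine ⟨Y₂, π, hπ.isProper, hπ.isBirational, fun x => ?_⟩
  haveI : CharP (Y₂.presheaf.stalk x) p :=
    Summit.ResolutionOfSingularities.ResolutionOfSingularities.Theorems.FRationalModification.Negative.charP_stalk
      (π ≫ g) x
  exact Summit.ResolutionOfSingularities.ResolutionOfSingularities.Theorems.FRationalModification.Negative.rungThree_of_isRegularLocalRing
    (Fact.out : p.Prime) _ (hπ.isRegular x)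

/-- **`stub_certifiedModel` holds unconditionally in dimension `≤ 1`**: an integral `Y/k` of finite
type with `dim Y ≤ 1` is resolved by its normalisation (tree `hasResolution_of_dim_le_one`, no named
fact), and a resolution witnesses the stub (`certifiedModel_of_hasResolution`). [folklore] -/
theorem certifiedModel_of_dim_le_one (p : ℕ) [Fact p.Prime] (k : Type) [Field k] [CharP k p]
    (Y : Scheme.{0}) (g : Y ⟶ Spec (.of k)) [LocallyOfFiniteType g] [QuasiCompact g] [IsIntegral Y]
    (hdim : topologicalKrullDim Y ≤ 1) :
    ∃ (W : Scheme.{0}) (π : W ⟶ Y), IsProper π ∧ IsBirational π ∧ ∀ w : W,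
      IsDomain (W.presheaf.stalk w) ∧
      ((∀ d : ℕ, ringKrullDim (W.presheaf.stalk w) = d → ∀ s : Fin d → W.presheaf.stalk w,
          (Ideal.span (Set.range s)).radical.IsMaximal → ∀ y c : W.presheaf.stalk w, c ≠ 0 →
            (∀ e : ℕ, c * y ^ p ^ e ∈
              Ideal.span ((fun z : W.presheaf.stalk w => z ^ p ^ e) ''
                (Ideal.span (Set.range s) : Set (W.presheaf.stalk w)))) →
            y ∈ Ideal.span (Set.range s)) ∨
        ∃ t : W.presheaf.stalk w, t ∈ maximalIdeal (W.presheaf.stalk w) ∧ t ≠ 0 ∧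
          IsRegularRing (Localization.Away t) ∧
          ∀ d : ℕ, ringKrullDim (W.presheaf.stalk w ⧸ Ideal.span {t}) = d →
            ∀ u : Fin d → W.presheaf.stalk w ⧸ Ideal.span {t},
              (Ideal.span (Set.range u)).radical.IsMaximal →
                RingTheory.Sequence.IsWeaklyRegular (W.presheaf.stalk w ⧸ Ideal.span {t})
                  (List.ofFn u) ∧
                ∀ y : W.presheaf.stalk w ⧸ Ideal.span {t}, (∃ e : ℕ, y ^ p ^ e ∈
                  Ideal.span ((fun z : W.presheaf.stalk w ⧸ Ideal.span {t} => z ^ p ^ e) ''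
                    (Ideal.span (Set.range u) : Set (W.presheaf.stalk w ⧸ Ideal.span {t})))) →
                  y ∈ Ideal.span (Set.range u)) :=
  certifiedModel_of_hasResolution p k Y g (hasResolution_of_dim_le_one Y g hdim)

/-! ## The composition -/

/-- **The crux `FRationalModification` from the stubs.** Reduce to integral rung-2 schemes
(`stub_reduction`); on an integral rung-2 `Y` take the certified model `W → Y` of
`stub_certifiedModel`; at `w ∈ W` the stalk is a domain which is rung-3 either by fiat or by its ring
certificate (`rungThree_of_certificate`: `stub_stalkSubmodels`, `stub_testExponent`,
`stub_deformFWPointwise`, `stub_divisorCertificate` and the landed Fedder–Watanabe chain). -/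
theorem FRationalModification_of : FRationalModification := by
  intro p hp k _ _ X f hsep hft hqc _ hX₁
  haveI : Fact p.Prime := ⟨hp⟩
  haveI := hsep; haveI := hft; haveI := hqc
  refine stub_reduction p k X f (fun Y g hs hl hq hY h₂ => ?_) hX₁
  haveI := hs; haveI := hl; haveI := hq; haveI := hY
  obtain ⟨W, π, hπ, hbir, hcert⟩ := stub_certifiedModel p k Y g h₂
  haveI := hπ
  refine ⟨W, π, hπ, hbir, fun w => ?_⟩
  obtain ⟨hdom, hw⟩ := hcert w
  haveI := hdom
  exact ⟨hdom, rungThree_of_certificate p (π ≫ g) w hw⟩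

end Summit.ResolutionOfSingularities.ResolutionOfSingularities.Cruxes.FRationalModification.Lines.Sketch

end
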